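import Literature.NumberTheory.LFunctions.MertensFormula
import Literature.NumberTheory.LFunctions.MertensElementary
import Mathlib.Analysis.MeanInequalities
import Mathlib.Analysis.SpecificLimits.Normed
import HarnessLib

/-!
# Step (iii) of Tao–Teräväinen at `k = 0`, elementary estimates: the Mertens bound
# `∑_{p ≤ R} min(σ log_R p, 1)/p ≪ 1 + log σ`, geometric tails, and a power-of-integral inequality

Topic `Literature/Barriers/Parity`, sub-namespace `TaoTeravainen`; a file of the proof DAG of
`Literature.Barriers.Parity.TaoTeravainen2021_chowla`, towards `TaoTeravainen2021_prop63_k0`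
(Proposition 6.3 at `k = 0`). Everything here is PROVED; no definitions.

* `sum_min_div_prime_le` — **(3.3)**: "From Mertens' theorem we easily verify that
  `∑_{p ≤ z} min(σ log_R p, 1)/p ≪ log(1 + σ log_R z)` for any `σ > 0` and `R, z ≥ 1`, as can be seen
  by verifying the cases `σ log_R z < 1` and `σ log_R z ≥ 1` separately" — here at `z = R`, in the
  explicit form `∑_{p ≤ M} min(σ log p / L, 1)/p ≤ log σ + 30` for `σ ≥ 1`, `L ≥ log M` (primes with
  `σ log p ≤ L` by Mertens' first theorem, the others by the two-sided second theorem of the tree,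
  `Literature.NumberTheory.LFunctions.Mertens.abs_primeRecipSum_sub_le`).
  [cite: TaoTeravainen2021, §3.1 (3.3)]
* `one_add_pow_sub_one_le`, `min_pow_sub_one_le` — `(1 + u)^s - 1 ≤ (2^s - 1) u` on `[0, 1]` and the
  capped form (the source's "`exp(O(a_{t,p})) ≤ 1 + O(min((1+|t|) log_R p, 1))`"); [folklore]
* `exists_tail_bound` — `∑_{k ≥ 2} (2k+1)^s p^{-3k/4} ≤ Z_s p^{-3/2}` (the source's "For `j ≥ 2` we use
  the crude bound … `≪_A 1/p²`", with `3/2` for `2`); [cite: TaoTeravainen2021, §6 (proof of (6.5))]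
* `mul_mul_pow_le_young`, `pow_integral_mul_le` — Young's inequality `s·a·b^{s-1} ≤ a^s + (s-1) b^s`
  and its consequence `(∫ w u)^s ≤ (∫ w)^{s-1} ∫ w u^s` for `w, u ≥ 0` (used to pass from
  `|λ♭(n)| ≤ ∫ |f(t)| |β_t(n)| dt` to `s`-th moments). [folklore]
-/

noncomputable section

open Finset Real MeasureTheory

namespace Literature.Barriers.Parity.TaoTeravainen

/-! ### (3.3): `∑_{p ≤ R} min(σ log_R p, 1)/p ≪ 1 + log σ` -/

/-- **Tao–Teräväinen (3.3) at `z = R`, explicit**: for `M ≥ 2`, `σ ≥ 1` and `L ≥ log M`,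
`∑_{p ≤ M} min(σ log p / L, 1)/p ≤ log σ + 30`. The primes with `σ log p ≤ L` (i.e. `p ≤ e^{L/σ}`)
contribute `≤ (σ/L)(L/σ + log 4) ≤ 3` by Mertens' first theorem; the others lie in
`(M^{1/σ}, M]` and contribute `≤ log log M - log log M^{1/σ} + 16/log 2 = log σ + 16/log 2` by the
two-sided Mertens second theorem (or `≤ log log M + 4 ≤ log σ + 4` when `M^{1/σ} < 2`).
[cite: TaoTeravainen2021, §3.1 (3.3)] -/
theorem sum_min_div_prime_le {M : ℕ} (hM : 2 ≤ M) {L σ : ℝ} (hσ : 1 ≤ σ) (hL : Real.log M ≤ L) :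
    ∑ p ∈ Nat.primesBelow (M + 1), min (σ * Real.log p / L) 1 / p ≤ Real.log σ + 30 := by
  have hM2 : (2 : ℝ) ≤ M := by exact_mod_cast hM
  have hlogM : 0 < Real.log M := Real.log_pos (by linarith)
  have hlog2 : (0.6931471803 : ℝ) < Real.log 2 := Real.log_two_gt_d9
  have hlog2' : 0 < Real.log 2 := by linarith
  have hL0 : 0 < L := by
    have : Real.log 2 ≤ Real.log M := Real.log_le_log two_pos hM2
    linarith
  have hσ0 : 0 < σ := by linarith
  set S := Nat.primesBelow (M + 1) with hS
  have hSle : S = Nat.primesLE M := rfl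
  have hmemS : ∀ p ∈ S, p.Prime ∧ p ≤ M := fun p hp => by
    rw [Nat.mem_primesBelow] at hp
    exact ⟨hp.2, Nat.lt_succ_iff.mp hp.1⟩
  set g : ℕ → ℝ := fun p => min (σ * Real.log p / L) 1 / p with hg
  have hg0 : ∀ p ∈ S, 0 ≤ g p := fun p hp => by
    have hp2 : (2 : ℝ) ≤ p := by exact_mod_cast (hmemS p hp).1.two_le
    exact div_nonneg (le_min (by positivity) zero_le_one) (by linarith)
  rw [← Finset.sum_filter_add_sum_filter_not S (fun p : ℕ => σ * Real.log (p : ℝ) ≤ L)]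
  -- low part
  have hlow : ∑ p ∈ S.filter (fun p : ℕ => σ * Real.log (p : ℝ) ≤ L), g p ≤ 3 := by
    set A := S.filter (fun p : ℕ => σ * Real.log (p : ℝ) ≤ L) with hA
    rcases A.eq_empty_or_nonempty with hAe | ⟨p₀, hp₀⟩
    · rw [hAe, sum_empty]; norm_num
    · obtain ⟨hp₀S, hp₀L⟩ := mem_filter.mp hp₀
      have hp₀2 : (2 : ℝ) ≤ p₀ := by exact_mod_cast (hmemS p₀ hp₀S).1.two_le
      -- `σ log 2 ≤ L`
      have hσL : σ * Real.log 2 ≤ L :=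
        (mul_le_mul_of_nonneg_left (Real.log_le_log two_pos hp₀2) hσ0.le).trans hp₀L
      set m : ℕ := min M ⌊Real.exp (L / σ)⌋₊ with hm
      have hAsub : A ⊆ Nat.primesLE m := by
        intro p hp
        obtain ⟨hpS, hpL⟩ := mem_filter.mp hp
        obtain ⟨hpp, hpM⟩ := hmemS p hpS
        rw [Nat.primesLE, Nat.mem_primesBelow, Nat.lt_succ_iff]
        refine ⟨le_min hpM (Nat.le_floor ?_), hpp⟩
        have hp0 : (0 : ℝ) < p := by exact_mod_cast hpp.pos
        rw [← Real.log_le_iff_le_exp hp0, le_div_iff₀ hσ0, mul_comm]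
        exact hpL
      have hsum : ∑ p ∈ A, g p = σ / L * ∑ p ∈ A, Real.log p / p := by
        rw [Finset.mul_sum]
        refine sum_congr rfl fun p hp => ?_
        obtain ⟨-, hpL⟩ := mem_filter.mp hp
        rw [hg]
        dsimp only
        rw [min_eq_left (by rw [div_le_one hL0]; exact hpL)]
        ring
      have hlogm : Real.log m ≤ L / σ := by
        rcases Nat.eq_zero_or_pos m with hm0 | hm0
        · rw [hm0, Nat.cast_zero, Real.log_zero]; positivity
        · calc Real.log m ≤ Real.log (Real.exp (L / σ)) := by
                refine Real.log_le_log (by exact_mod_cast hm0) ?_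
                exact (Nat.cast_le.mpr (min_le_right _ _)).trans (Nat.floor_le (Real.exp_pos _).le)
            _ = L / σ := Real.log_exp _
      calc ∑ p ∈ A, g p = σ / L * ∑ p ∈ A, Real.log p / p := hsum
        _ ≤ σ / L * ∑ p ∈ Nat.primesLE m, Real.log p / p := by
            refine mul_le_mul_of_nonneg_left (sum_le_sum_of_subset_of_nonneg hAsub fun p hp _ => ?_)
              (by positivity)
            have := (Nat.mem_primesBelow.mp hp).2
            exact div_nonneg (Real.log_nonneg (by exact_mod_cast this.one_lt.le)) (Nat.cast_nonneg _)
        _ ≤ σ / L * (Real.log m + Real.log 4) := mul_le_mul_of_nonneg_left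
            (Literature.NumberTheory.LFunctions.MertensBound.sum_log_div_prime_le m) (by positivity)
        _ ≤ σ / L * (L / σ + Real.log 4) := by gcongr
        _ = 1 + σ * Real.log 4 / L := by field_simp
        _ ≤ 3 := by
            have h4 : Real.log 4 = 2 * Real.log 2 := by
              rw [show (4 : ℝ) = 2 ^ 2 by norm_num, Real.log_pow]; norm_num
            have h5 : σ * Real.log 4 / L ≤ 2 := by
              rw [h4, div_le_iff₀ hL0]; nlinarith
            linarith
  -- high part
  have hhigh : ∑ p ∈ S.filter (fun p : ℕ => ¬ σ * Real.log (p : ℝ) ≤ L), g p ≤ Real.log σ + 24 := by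
    set B := S.filter (fun p : ℕ => ¬ σ * Real.log (p : ℝ) ≤ L) with hB
    have hBle : ∑ p ∈ B, g p ≤ ∑ p ∈ B, (p : ℝ)⁻¹ := by
      refine sum_le_sum fun p hp => ?_
      have hp0 : (0 : ℝ) < p := by exact_mod_cast (hmemS p (mem_filter.mp hp).1).1.pos
      rw [hg]; dsimp only
      rw [div_le_iff₀ hp0, inv_mul_cancel₀ hp0.ne']
      exact min_le_right _ _
    refine hBle.trans ?_
    set y : ℝ := (M : ℝ) ^ (1 / σ) with hy
    have hy0 : 0 < y := Real.rpow_pos_of_pos (by linarith) _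
    have hlogy : Real.log y = Real.log M / σ := by
      rw [hy, Real.log_rpow (by linarith)]; ring
    -- primes in `B` exceed `y`
    have hBy : ∀ p ∈ B, y < p := by
      intro p hp
      obtain ⟨hpS, hpL⟩ := mem_filter.mp hp
      have hp0 : (0 : ℝ) < p := by exact_mod_cast (hmemS p hpS).1.pos
      rw [not_le] at hpL
      rw [← Real.log_lt_log_iff hy0 hp0, hlogy, div_lt_iff₀ hσ0, mul_comm]
      exact hL.trans_lt hpL
    rcases lt_or_ge y 2 with hy2 | hy2
    · -- `M^{1/σ} < 2`: `log log M ≤ log σ`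
      have hMσ : Real.log M < σ * Real.log 2 := by
        have : Real.log y < Real.log 2 := Real.log_lt_log hy0 hy2
        rw [hlogy, div_lt_iff₀ hσ0] at this
        linarith
      have hll : Real.log (Real.log M) ≤ Real.log σ := by
        calc Real.log (Real.log M) ≤ Real.log (σ * Real.log 2) := Real.log_le_log hlogM hMσ.le
          _ = Real.log σ + Real.log (Real.log 2) := Real.log_mul hσ0.ne' hlog2'.ne'
          _ ≤ Real.log σ := by
              have : Real.log (Real.log 2) < 0 := Real.log_neg hlog2' (by
                have := Real.log_two_lt_d9; linarith)
              linarith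
      calc ∑ p ∈ B, (p : ℝ)⁻¹ ≤ ∑ p ∈ S, (p : ℝ)⁻¹ :=
            sum_le_sum_of_subset_of_nonneg (filter_subset _ _) fun p _ _ => by positivity
        _ = ∑ p ∈ Nat.primesLE M, (1 : ℝ) / p := by rw [hSle]; simp
        _ ≤ Real.log (Real.log M) + 4 :=
            Literature.NumberTheory.LFunctions.MertensBound.sum_inv_prime_le M hM
        _ ≤ Real.log σ + 24 := by linarith
    · -- `2 ≤ M^{1/σ}`: two-sided Mertens
      have hyM : y ≤ M := by
        rw [hy]
        calc (M : ℝ) ^ (1 / σ) ≤ (M : ℝ) ^ (1 : ℝ) :=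
              Real.rpow_le_rpow_of_exponent_le (by linarith) (by
                rw [div_le_one hσ0]; exact hσ)
          _ = M := Real.rpow_one _
      have hsub : Nat.primesLE ⌊y⌋₊ ⊆ Nat.primesLE M := by
        intro p hp
        rw [Nat.primesLE, Nat.mem_primesBelow, Nat.lt_succ_iff] at hp ⊢
        exact ⟨hp.1.trans (Nat.floor_le_of_le (by simpa using hyM)), hp.2⟩
      have hBsub : B ⊆ Nat.primesLE M \ Nat.primesLE ⌊y⌋₊ := by
        intro p hp
        rw [mem_sdiff]
        refine ⟨by rw [← hSle]; exact (mem_filter.mp hp).1, fun h => ?_⟩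
        rw [Nat.primesLE, Nat.mem_primesBelow, Nat.lt_succ_iff] at h
        have h1 : (p : ℝ) ≤ ⌊y⌋₊ := by exact_mod_cast h.1
        linarith [Nat.floor_le hy0.le, hBy p hp]
      have hdiff : ∑ p ∈ Nat.primesLE M \ Nat.primesLE ⌊y⌋₊, (p : ℝ)⁻¹ =
          Literature.NumberTheory.LFunctions.Mertens.primeRecipSum M -
            Literature.NumberTheory.LFunctions.Mertens.primeRecipSum y := by
        rw [Literature.NumberTheory.LFunctions.Mertens.primeRecipSum,
          Literature.NumberTheory.LFunctions.Mertens.primeRecipSum, Nat.floor_natCast,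
          eq_sub_iff_add_eq, sum_sdiff hsub]
      have h1 := Literature.NumberTheory.LFunctions.Mertens.abs_primeRecipSum_sub_le hM2
      have h2 := Literature.NumberTheory.LFunctions.Mertens.abs_primeRecipSum_sub_le hy2
      rw [abs_le] at h1 h2
      have hlog2y : Real.log 2 ≤ Real.log y := Real.log_le_log two_pos hy2
      have hlogy0 : 0 < Real.log y := by linarith
      have e1 : 8 / Real.log M ≤ 8 / Real.log 2 :=
        div_le_div_of_nonneg_left (by norm_num) hlog2' (Real.log_le_log two_pos hM2)
      have e2 : 8 / Real.log y ≤ 8 / Real.log 2 := div_le_div_of_nonneg_left (by norm_num) hlog2' hlog2y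
      have e3 : 8 / Real.log 2 ≤ 12 := by rw [div_le_iff₀ hlog2']; linarith
      have hll : Real.log (Real.log M) - Real.log (Real.log y) = Real.log σ := by
        rw [hlogy, Real.log_div hlogM.ne' hσ0.ne']; ring
      calc ∑ p ∈ B, (p : ℝ)⁻¹ ≤ ∑ p ∈ Nat.primesLE M \ Nat.primesLE ⌊y⌋₊, (p : ℝ)⁻¹ :=
            sum_le_sum_of_subset_of_nonneg hBsub fun p _ _ => by positivity
        _ = _ := hdiff
        _ ≤ Real.log σ + 24 := by linarith
  linarith

/-! ### Elementary inequalities -/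

/-- `(1 + u)^s - 1 ≤ (2^s - 1) u` for `0 ≤ u ≤ 1`. [folklore] -/
theorem one_add_pow_sub_one_le {u : ℝ} (hu0 : 0 ≤ u) (hu1 : u ≤ 1) (s : ℕ) :
    (1 + u) ^ s - 1 ≤ (2 ^ s - 1) * u := by
  induction s with
  | zero => simp
  | succ s ih =>
    have h1 : 1 ≤ (1 + u) ^ s := one_le_pow₀ (by linarith)
    have h2 : (1 : ℝ) ≤ 2 ^ s := one_le_pow₀ (by norm_num)
    rw [pow_succ, pow_succ]
    nlinarith

/-- The capped form: `min((1+u)^s, B) - 1 ≤ (2^s + B) min(u, 1)` for `u, B ≥ 0`. [folklore] -/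
theorem min_pow_sub_one_le {u B : ℝ} (hu : 0 ≤ u) (hB : 0 ≤ B) (s : ℕ) :
    min ((1 + u) ^ s) B - 1 ≤ (2 ^ s + B) * min u 1 := by
  rcases le_or_gt u 1 with hu1 | hu1
  · rw [min_eq_left hu1]
    have := one_add_pow_sub_one_le hu hu1 s
    nlinarith [min_le_left ((1 + u) ^ s) B]
  · rw [min_eq_right hu1.le]
    have h2 : (0 : ℝ) ≤ 2 ^ s := by positivity
    linarith [min_le_right ((1 + u) ^ s) B]

/-- **Geometric tails**: for each `s` there is `Z ≥ 0` such that for every `p ≥ 2` and every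
non-negative sequence with `u_k ≤ (2k+1)^s p^{-3k/4}` (`k ≥ 2`): `∑_{k ≥ 2} u_k ≤ Z p^{-3/2}` (and the
tail is summable). [cite: TaoTeravainen2021, §6 (proof of (6.5), the terms `j ≥ 2`)] -/
theorem exists_tail_bound (s : ℕ) : ∃ Z : ℝ, 0 ≤ Z ∧ ∀ p : ℕ, 2 ≤ p → ∀ u : ℕ → ℝ, (∀ k, 0 ≤ u k) →
    (∀ k : ℕ, 2 ≤ k → u k ≤ (2 * k + 1) ^ s * (p : ℝ) ^ (-(3 : ℝ) / 4 * k)) →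
      Summable (fun k => u (k + 2)) ∧ ∑' k, u (k + 2) ≤ Z * (p : ℝ) ^ (-(3 : ℝ) / 2) := by
  set ρ : ℝ := (2 : ℝ) ^ (-(3 : ℝ) / 4) with hρ
  have hρ0 : 0 < ρ := Real.rpow_pos_of_pos two_pos _
  have hρ1 : ρ < 1 := Real.rpow_lt_one_of_one_lt_of_neg one_lt_two (by norm_num)
  set g : ℕ → ℝ := fun k => (5 : ℝ) ^ s * ((k + 1 : ℕ) : ℝ) ^ s * ρ ^ k with hg
  have hgsum : Summable g := by
    have h0 : Summable fun k : ℕ => ((k : ℕ) : ℝ) ^ s * ρ ^ k :=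
      summable_pow_mul_geometric_of_norm_lt_one s (by rw [Real.norm_eq_abs, abs_of_pos hρ0]; exact hρ1)
    have h1 : Summable fun k : ℕ => (((k + 1 : ℕ) : ℝ) ^ s * ρ ^ (k + 1)) :=
      (summable_nat_add_iff (f := fun k : ℕ => ((k : ℕ) : ℝ) ^ s * ρ ^ k) 1).mpr h0
    refine (h1.mul_left ((5 : ℝ) ^ s * ρ⁻¹)).congr fun k => ?_
    simp only [hg, pow_succ]
    field_simp
  have hg0 : ∀ k, 0 ≤ g k := fun k => by positivity
  refine ⟨∑' k, g k, tsum_nonneg hg0, fun p hp u hu0 hu => ?_⟩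
  have hp0 : (0 : ℝ) < p := by exact_mod_cast (zero_lt_two.trans_le hp)
  have hp2 : (2 : ℝ) ≤ p := by exact_mod_cast hp
  set c : ℝ := (p : ℝ) ^ (-(3 : ℝ) / 2) with hc
  have hc0 : 0 < c := Real.rpow_pos_of_pos hp0 _
  have hbound : ∀ k : ℕ, u (k + 2) ≤ g k * c := by
    intro k
    have h1 := hu (k + 2) (by omega)
    have hk1 : ((2 * (k + 2 : ℕ) + 1 : ℝ)) ^ s ≤ (5 : ℝ) ^ s * ((k + 1 : ℕ) : ℝ) ^ s := by
      rw [← mul_pow]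
      exact pow_le_pow_left₀ (by positivity) (by push_cast; linarith) s
    have hk2 : (p : ℝ) ^ (-(3 : ℝ) / 4 * ((k + 2 : ℕ) : ℝ)) = c * (p : ℝ) ^ (-(3 : ℝ) / 4 * k) := by
      rw [hc, ← Real.rpow_add hp0]
      congr 1
      push_cast
      ring
    have hk3 : (p : ℝ) ^ (-(3 : ℝ) / 4 * k) ≤ ρ ^ k := by
      rw [hρ, ← Real.rpow_natCast, ← Real.rpow_mul zero_le_two]
      calc (p : ℝ) ^ (-(3 : ℝ) / 4 * k) ≤ (2 : ℝ) ^ (-(3 : ℝ) / 4 * k) :=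
            Real.rpow_le_rpow_of_nonpos two_pos hp2 (by
              have : (0 : ℝ) ≤ k := Nat.cast_nonneg k
              nlinarith)
        _ = (2 : ℝ) ^ (-(3 : ℝ) / 4 * (k : ℝ)) := rfl
    calc u (k + 2) ≤ (2 * ((k + 2 : ℕ) : ℝ) + 1) ^ s * (p : ℝ) ^ (-(3 : ℝ) / 4 * ((k + 2 : ℕ) : ℝ)) := by
          exact_mod_cast h1
      _ ≤ ((5 : ℝ) ^ s * ((k + 1 : ℕ) : ℝ) ^ s) * (c * ρ ^ k) := by
          rw [hk2]
          refine mul_le_mul (by exact_mod_cast hk1) (mul_le_mul_of_nonneg_left hk3 hc0.le)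
            (by positivity) (by positivity)
      _ = g k * c := by simp only [hg]; ring
  have hsum : Summable fun k => u (k + 2) :=
    Summable.of_nonneg_of_le (fun k => hu0 _) hbound (hgsum.mul_right c)
  refine ⟨hsum, ?_⟩
  calc ∑' k, u (k + 2) ≤ ∑' k, g k * c := hsum.tsum_le_tsum hbound (hgsum.mul_right c)
    _ = (∑' k, g k) * c := tsum_mul_right

/-! ### Young's inequality and powers of integrals -/

/-- Young's inequality with exponents `s` and `s/(s-1)`: `s·a·b^{s-1} ≤ a^s + (s-1) b^s` for
`a, b ≥ 0`, `s ≥ 1`. [folklore] -/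
theorem mul_mul_pow_le_young {a b : ℝ} (ha : 0 ≤ a) (hb : 0 ≤ b) {s : ℕ} (hs : 1 ≤ s) :
    (s : ℝ) * (a * b ^ (s - 1)) ≤ a ^ s + (s - 1) * b ^ s := by
  have hs0 : (0 : ℝ) < s := by exact_mod_cast hs
  have hw : (1 : ℝ) / s + ((s : ℝ) - 1) / s = 1 := by field_simp; ring
  have h := Real.geom_mean_le_arith_mean2_weighted (w₁ := 1 / s) (w₂ := ((s : ℝ) - 1) / s)
    (p₁ := a ^ s) (p₂ := b ^ s) (by positivity)
    (div_nonneg (by linarith [show (1 : ℝ) ≤ s by exact_mod_cast hs]) hs0.le) (by positivity)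
    (by positivity) hw
  have h1 : (a ^ s) ^ ((1 : ℝ) / s) = a := by
    rw [one_div]; exact Real.pow_rpow_inv_natCast ha (by omega)
  have h2 : (b ^ s) ^ (((s : ℝ) - 1) / s) = b ^ (s - 1) := by
    rw [← Real.rpow_natCast b s, ← Real.rpow_mul hb, ← Real.rpow_natCast b (s - 1)]
    congr 1
    rw [Nat.cast_sub hs, Nat.cast_one]
    field_simp
  rw [h1, h2] at h
  have h3 : (s : ℝ) * (1 / s * a ^ s + ((s : ℝ) - 1) / s * b ^ s) = a ^ s + (s - 1) * b ^ s := by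
    field_simp
  calc (s : ℝ) * (a * b ^ (s - 1)) ≤ (s : ℝ) * (1 / s * a ^ s + ((s : ℝ) - 1) / s * b ^ s) :=
        mul_le_mul_of_nonneg_left h hs0.le
    _ = a ^ s + (s - 1) * b ^ s := h3

/-- **Power of a weighted integral**: for `w, u ≥ 0` with `w`, `w u`, `w u^s` integrable and `s ≥ 1`,
`(∫ w u)^s ≤ (∫ w)^{s-1} ∫ w u^s` (Jensen for the probability measure `w/∫w`, via Young's
inequality). [folklore] -/
theorem pow_integral_mul_le {w u : ℝ → ℝ} (hw : ∀ t, 0 ≤ w t) (hu : ∀ t, 0 ≤ u t) {s : ℕ} (hs : 1 ≤ s)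
    (hwi : Integrable w) (hwu : Integrable fun t => w t * u t)
    (hwus : Integrable fun t => w t * u t ^ s) :
    (∫ t, w t * u t) ^ s ≤ (∫ t, w t) ^ (s - 1) * ∫ t, w t * u t ^ s := by
  set W := ∫ t, w t with hW
  set Y := ∫ t, w t * u t with hY
  set I := ∫ t, w t * u t ^ s with hI
  have hW0 : 0 ≤ W := integral_nonneg hw
  have hY0 : 0 ≤ Y := integral_nonneg fun t => mul_nonneg (hw t) (hu t)
  have hI0 : 0 ≤ I := integral_nonneg fun t => mul_nonneg (hw t) (pow_nonneg (hu t) s)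
  rcases hW0.eq_or_lt with hW00 | hWpos
  · -- `∫ w = 0`: `w = 0` a.e., so `Y = 0`
    have hae : w =ᵐ[volume] 0 := (integral_eq_zero_iff_of_nonneg_ae (ae_of_all _ hw) hwi).mp hW00.symm
    have hY00 : Y = 0 := by
      rw [hY]
      refine integral_eq_zero_of_ae (hae.mono fun t ht => ?_)
      simp [ht]
    rw [hY00, zero_pow (by omega)]
    exact mul_nonneg (pow_nonneg hW0 _) hI0
  · set y := Y / W with hy
    have hy0 : 0 ≤ y := div_nonneg hY0 hWpos.le
    have hYy : Y = y * W := by rw [hy]; field_simp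
    -- integrate Young's inequality `s w u y^{s-1} ≤ w u^s + (s-1) w y^s`
    have hpt : ∀ t, (s : ℝ) * y ^ (s - 1) * (w t * u t) ≤ w t * u t ^ s + ((s : ℝ) - 1) * y ^ s * w t := by
      intro t
      have := mul_le_mul_of_nonneg_left (mul_mul_pow_le_young (hu t) hy0 hs) (hw t)
      nlinarith
    have hI1 : Integrable (fun t => (s : ℝ) * y ^ (s - 1) * (w t * u t)) := hwu.const_mul _
    have hI2 : Integrable (fun t => w t * u t ^ s + ((s : ℝ) - 1) * y ^ s * w t) :=
      hwus.add (hwi.const_mul _)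
    have hint : ∫ t, (s : ℝ) * y ^ (s - 1) * (w t * u t) ≤
        ∫ t, (w t * u t ^ s + ((s : ℝ) - 1) * y ^ s * w t) := integral_mono hI1 hI2 hpt
    rw [integral_const_mul, integral_add hwus (hwi.const_mul _), integral_const_mul] at hint
    -- `s y^{s-1} Y ≤ I + (s-1) y^s W`, and `Y = y W`
    rw [← hY, ← hI, ← hW, hYy] at hint
    have hys : y ^ s = y ^ (s - 1) * y := by rw [← pow_succ, Nat.sub_add_cancel hs]
    have hWs : W ^ s = W ^ (s - 1) * W := by rw [← pow_succ, Nat.sub_add_cancel hs]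
    have hkey : y ^ s * W ≤ I := by
      have : (s : ℝ) * y ^ (s - 1) * (y * W) = s * (y ^ s * W) := by rw [hys]; ring
      rw [this] at hint
      nlinarith
    calc Y ^ s = (y * W) ^ s := by rw [hYy]
      _ = y ^ s * W * W ^ (s - 1) := by rw [mul_pow, hWs]; ring
      _ ≤ I * W ^ (s - 1) := mul_le_mul_of_nonneg_right hkey (pow_nonneg hW0 _)
      _ = W ^ (s - 1) * I := mul_comm _ _

end Literature.Barriers.Parity.TaoTeravainen
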